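import Summits.QuantumFields.BalabanUV.T4Continuum.Support.ScalarGaugeProjectionUnit
import Summits.QuantumFields.BalabanUV.T4Continuum.Support.SubtypeCompression

/-!
# T⁴ programme, spine node NE2 (U1a), sub-row Δ1 «NE2⁰-Dirichlet» — THE REGION GAUGE PROJECTION OF [B9] (3.25): for ANY Hermitian
# invertible `G′` («the region's scalar Dirichlet propagator») and ANY averaging `Q′`, `P = G′Q′ᴴ(Q′G′²Q′ᴴ)⁻¹Q′G′` is the orthogonal
# projection onto `G′·range(Q′ᴴ)`, `R = 1 − P` the orthogonal projection onto `ker(Q′G′) = Δ′_a N(Q′)` ((3.21) ⟺ (3.25)), with the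
# (3.48)-shape bound `‖(Q′G′²Q′ᴴ)⁻¹‖ ≤ ‖Δ′_a‖²/c` — generic finite-dimensional algebra, region- and background-independent

Twelfth generation of the NE2 prover lineage P1 of the cell `pub-balaban` (row NE2 owner), file 3 (owner item O12-c, located delta
G-ne2p1-g12-1, journal 2026-08-20 l.14713).  WHAT IS PRINTED ([Balaban1985BackgroundPropagators] pp. 394–395, renders read as images):
«R = R(U) is an orthogonal projection in the Hilbert space L²(Ω₀, g) onto the subspace R = Δ^η_U N(Q′), N(Q′) = {λ : Q′λ = 0}» (3.21);
«For an arbitrary function f ∈ L²(Ω₀, g) we have Rf = Δ^η_U λ₀, where λ₀ is a minimum of the function λ ∈ N(Q′), λ → ‖f − Δ^η_U λ‖²» (3.22);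
«Δ′_a = Δ′_a(U) = (Δ^η_U + Q′*aQ′)↾Ω₀ … Its inverse is denoted by G′» (3.24); «Using the Lagrange multipliers method the minimum of (3.22)
can be found … and we obtain the formula Rf = (I − G′Q′*(Q′G′²Q′*)⁻¹Q′G′)f, where G′ = G′(U) = (Δ′_a)⁻¹» (3.25); «Assuming some regularity
of the configuration U it can be easily shown that the operator Δ′_a is positive. This implies positivity of the operators G′, Q′G′²Q′*,
hence the existence of the operator R» (p. 395); «Δ_a = Δ + DRD* + Q*aQ. It coincides with Δ_a in (2.19) if U = 1» (3.26); and Theorem 3.2's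
shape «|(Q′(U)G′²(U)Q′*(U))⁻¹(y, y′)| ≤ B₀(L^jη)^{−4} …» (3.48).

WHY THIS FILE (the located delta).  The lineage's Δ1 vector tower `DirichletRegionTower.DalevR = (Δ_a^{(k)})_{ΩΩ}` compresses B5's TORUS
`Δ_a = Δ − ∂P_T∂* + aQ*Q`, i.e. the gauge projection of the WHOLE torus, whereas (3.26) builds the gauge term `DRD*` from THE REGION's
`G′ = G′(Ω₀)` through (3.25); the two coincide iff `Ω₀ = T`.  Tier B's row B4.c certified the TORUS instance of (3.25) at `U = 1`
(`ScalarGaugeProjectionUnit.Pone = PcT + Pker`, leaf-09).  This file proves the algebra of (3.25) for ARBITRARY data — any region, any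
background, any averaging — so that the [B9]-faithful region operator can be typed with `R(Ω₀)` once the region's `G′` is supplied
(at `U = 1`: `Support/DirichletScalarTower`'s `DsR`):

 * §1 `gramK G Q = Q·G·G·Qᴴ` ((3.25)'s `Q′G′²Q′ᴴ`), `gaugeP G Q = G·Qᴴ·(gramK)⁻¹·Q·G` (= `1 − R`), `gaugeR G Q = 1 − gaugeP G Q`; the
   torus instance of row B4.c IS `gaugeP (Gps n M a′) (QsOp n M)` (kernel `example`, `rfl`).
 * §2 THE PROJECTION ALGEBRA (for `G` Hermitian, `gramK` invertible): `gaugeP`, `gaugeR` are Hermitian idempotents;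
   **`Q_mul_G_mul_gaugeR`** `Q·G·R = 0` (range `R ⊆ ker(QG)`) and **`gaugeR_mulVec_of_ker`** (`QGf = 0 ⟹ Rf = f`): `R` IS the orthogonal
   projection onto `ker(Q′G′)`; and (3.21)'s wording **`gaugeR_mulVec_D_mulVec`**: for `G·D = 1` (`D = Δ′_a`) and `Q′λ = 0`, `R(Δ′_aλ) = Δ′_aλ`,
   while `Q′·(G′·Rf) = 0` for every `f` (`Rf ∈ Δ′_a N(Q′)`).
 * §3 EXISTENCE / THE (3.48) SHAPE: if `G` is Hermitian with a two-sided inverse `D` and `Q·Qᴴ = c·1`, then `gramK` is COERCIVE with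
   constant `c/‖D‖²` (`⟨v, Kv⟩ = ‖GQᴴv‖² ≥ ‖Qᴴv‖²/‖D‖² = c‖v‖²/‖D‖²`), hence invertible with **`‖(gramK)⁻¹‖ ≤ ‖D‖²/c`** — Bałaban's
   «positivity of Δ′_a ⟹ positivity of G′, Q′G′²Q′* ⟹ existence of R», with the constant.
 * §4 NORMS: `‖gaugeP‖ ≤ 1`, `‖gaugeR‖ ≤ 1`.
 * §5 THE MINIMISATION (3.22): `‖f − Rf‖² ≤ ‖f − Δ′_aλ‖²` for every `λ ∈ N(Q′)`.

HONEST FRAMING (T4-DAG p. 1).  [folklore] finite-dimensional linear algebra — OUR formalisation of the printed derivation (3.21)–(3.25) for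
abstract data; nothing printed is a hypothesis; NOT the regularity of `R(U)` ((3.49)), NOT the region vector operator (3.26)–(3.27) itself
(its coercivity on a region is [B6] §2-type content, not in the tree), NOT B0.  NE2 (U1a) NOT proved; spine 0/9 unchanged; NOT infinite
volume / mass gap / Clay / summit progress.  HONEST DEPENDENCY: continuum YM on T⁴ ⇐ BetaPertH ∧ nine spine estimates (0/9 proved); BetaPertH ⇐
(D1) ∧ (D4) ∧ CAP+tail; G-an2-4 gates asym, D1 and NE2/3/4.  No `sorry`.
-/

noncomputable section

open scoped BigOperators ComplexConjugate Matrix Matrix.Norms.L2Operator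

namespace Summit.QuantumFields.BalabanUV.T4Continuum.RegionGaugeProjection

open Literature.MathematicalPhysics.QuantumFieldTheory.Balaban1983to89.B5Prop11Plancherel (opNorm_le_of_sq_le)
open Literature.MathematicalPhysics.QuantumFieldTheory.Balaban1983to89.B5Prop11Lower (nsq nsq_nonneg star_dotProduct_self
  norm_star_dotProduct_le nsq_mulVec_le)
open Literature.MathematicalPhysics.QuantumFieldTheory.Balaban1983to89.B5Action121 (star_mulVec_dotProduct
  dotProduct_mulVec_eq_star_conjTranspose_mulVec)
open Summit.QuantumFields.BalabanUV.T4Continuum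
open Summit.QuantumFields.BalabanUV.T4Continuum.SubtypeCompression (Coercive isUnit_det_of_coercive opNorm_inv_le_of_coercive)

variable {m u : Type*} [Fintype m] [DecidableEq m] [Fintype u] [DecidableEq u]

/-! ## §1 The objects of (3.25) for abstract data -/

/-- `K = Q′·G′·G′·Q′ᴴ` — the operator `Q′G′²Q′*` inverted in (3.25). [cite: Balaban1985BackgroundPropagators, (3.25) p.394] [folklore] -/
def gramK (G : Matrix m m ℂ) (Q : Matrix u m ℂ) : Matrix u u ℂ := Q * G * G * Qᴴ

/-- `P = G′·Q′ᴴ·(Q′G′²Q′ᴴ)⁻¹·Q′·G′` — the operator `1 − R` of (3.25). [cite: Balaban1985BackgroundPropagators, (3.25) p.394] [folklore] -/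
def gaugeP (G : Matrix m m ℂ) (Q : Matrix u m ℂ) : Matrix m m ℂ := G * Qᴴ * (gramK G Q)⁻¹ * Q * G

/-- `R = 1 − G′Q′ᴴ(Q′G′²Q′ᴴ)⁻¹Q′G′` — the gauge projection (3.25). [cite: Balaban1985BackgroundPropagators, (3.25) p.394] [folklore] -/
def gaugeR (G : Matrix m m ℂ) (Q : Matrix u m ℂ) : Matrix m m ℂ := 1 - gaugeP G Q

/-- **CONSISTENCY WITH ROW B4.c (kernel)**: the `U = 1` torus projection `ScalarGaugeProjectionUnit.Pone` (certified there to equal B5's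
`PcT + Pker`) IS `gaugeP` of the torus scalar propagator `Gps` and Bałaban's block averaging `QsOp` — by `rfl`. -/
example {d : ℕ} (n : ℕ) [NeZero n] (M : Fin d → ℕ) [∀ μ, NeZero (M μ)] (a' : ℝ) :
    ScalarGaugeProjectionUnit.Pone n M a'
      = gaugeP (ScalarAveragedPropagator.Gps n M a') (Literature.MathematicalPhysics.QuantumFieldTheory.Balaban1983to89.B5Block118.QsOp n M) :=
  rfl

variable (G : Matrix m m ℂ) (Q : Matrix u m ℂ)

/-! ## §2 The projection algebra: `R` is the orthogonal projection onto `ker(Q′G′) = Δ′_a N(Q′)` -/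

omit [DecidableEq m] [Fintype u] [DecidableEq u] in
/-- `K` is Hermitian when `G` is. [folklore] -/
theorem gramK_isHermitian (hG : G.IsHermitian) : (gramK G Q).IsHermitian := by
  unfold Matrix.IsHermitian gramK
  rw [Matrix.conjTranspose_mul, Matrix.conjTranspose_mul, Matrix.conjTranspose_mul, Matrix.conjTranspose_conjTranspose, hG.eq]
  simp only [Matrix.mul_assoc]

omit [DecidableEq m] in
/-- `P` is Hermitian when `G` is. [folklore] -/
theorem gaugeP_isHermitian (hG : G.IsHermitian) : (gaugeP G Q).IsHermitian := by
  have hK := gramK_isHermitian G Q hG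
  unfold Matrix.IsHermitian gaugeP
  rw [Matrix.conjTranspose_mul, Matrix.conjTranspose_mul, Matrix.conjTranspose_mul, Matrix.conjTranspose_mul,
    Matrix.conjTranspose_conjTranspose, hG.eq, Matrix.conjTranspose_nonsing_inv, hK.eq]
  simp only [Matrix.mul_assoc]

/-- `R` is Hermitian when `G` is. [folklore] -/
theorem gaugeR_isHermitian (hG : G.IsHermitian) : (gaugeR G Q).IsHermitian := by
  unfold Matrix.IsHermitian gaugeR
  rw [Matrix.conjTranspose_sub, Matrix.conjTranspose_one, (gaugeP_isHermitian G Q hG).eq]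

omit [DecidableEq m] in
/-- `Q·G·P = Q·G` (so `Q·G·R = 0`). [folklore] -/
theorem Q_mul_G_mul_gaugeP (hK : IsUnit (gramK G Q).det) : Q * G * gaugeP G Q = Q * G := by
  unfold gaugeP
  calc Q * G * (G * Qᴴ * (gramK G Q)⁻¹ * Q * G) = (Q * G * G * Qᴴ) * (gramK G Q)⁻¹ * (Q * G) := by
        simp only [Matrix.mul_assoc]
    _ = Q * G := by rw [← gramK, Matrix.mul_nonsing_inv _ hK, Matrix.one_mul]

omit [DecidableEq m] in
/-- `P·(G·Qᴴ) = G·Qᴴ` (`P` fixes `G′·range(Q′ᴴ)`). [folklore] -/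
theorem gaugeP_mul_G_mul_QH (hK : IsUnit (gramK G Q).det) : gaugeP G Q * (G * Qᴴ) = G * Qᴴ := by
  unfold gaugeP
  calc G * Qᴴ * (gramK G Q)⁻¹ * Q * G * (G * Qᴴ) = G * Qᴴ * ((gramK G Q)⁻¹ * (Q * G * G * Qᴴ)) := by
        simp only [Matrix.mul_assoc]
    _ = G * Qᴴ := by rw [← gramK, Matrix.nonsing_inv_mul _ hK, Matrix.mul_one]

omit [DecidableEq m] in
/-- **`P² = P`**. [folklore] -/
theorem gaugeP_mul_gaugeP (hK : IsUnit (gramK G Q).det) : gaugeP G Q * gaugeP G Q = gaugeP G Q := by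
  have h := gaugeP_mul_G_mul_QH G Q hK
  have e : gaugeP G Q * gaugeP G Q = (gaugeP G Q * (G * Qᴴ)) * ((gramK G Q)⁻¹ * Q * G) := by
    simp only [gaugeP, Matrix.mul_assoc]
  rw [e, h]
  simp only [gaugeP, Matrix.mul_assoc]

/-- **`R² = R`**. [folklore] -/
theorem gaugeR_mul_gaugeR (hK : IsUnit (gramK G Q).det) : gaugeR G Q * gaugeR G Q = gaugeR G Q := by
  unfold gaugeR
  rw [Matrix.sub_mul, Matrix.one_mul, Matrix.mul_sub, Matrix.mul_one, gaugeP_mul_gaugeP G Q hK, sub_self, sub_zero]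

/-- **RANGE `R ⊆ ker(Q′G′)`**: `Q·G·R = 0`. [cite: Balaban1985BackgroundPropagators, (3.21)/(3.25) p.394] [folklore] -/
theorem Q_mul_G_mul_gaugeR (hK : IsUnit (gramK G Q).det) : Q * G * gaugeR G Q = 0 := by
  unfold gaugeR
  rw [Matrix.mul_sub, Matrix.mul_one, Q_mul_G_mul_gaugeP G Q hK, sub_self]

/-- **`ker(Q′G′) ⊆` FIXED POINTS OF `R`**: `Q·(G·f) = 0 ⟹ R·f = f` (no invertibility needed). Together with `Q_mul_G_mul_gaugeR` and the
Hermitian/idempotent laws: `R` is THE ORTHOGONAL PROJECTION ONTO `ker(Q′G′)`. [cite: Balaban1985BackgroundPropagators, (3.21)/(3.25) p.394] [folklore] -/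
theorem gaugeR_mulVec_of_ker (f : m → ℂ) (hf : Q *ᵥ (G *ᵥ f) = 0) : gaugeR G Q *ᵥ f = f := by
  unfold gaugeR gaugeP
  rw [Matrix.sub_mulVec, Matrix.one_mulVec, sub_eq_self]
  simp only [← Matrix.mulVec_mulVec]
  rw [hf, Matrix.mulVec_zero, Matrix.mulVec_zero, Matrix.mulVec_zero]

/-- (3.21) IN BAŁABAN's WORDS, first half: for `G·D = 1` (`D = Δ′_a = G′⁻¹`) and `λ ∈ N(Q′)`, `R(Δ′_aλ) = Δ′_aλ` — `R` fixes `Δ′_a N(Q′)`.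
[cite: Balaban1985BackgroundPropagators, (3.21) p.394] [folklore] -/
theorem gaugeR_mulVec_D_mulVec {D : Matrix m m ℂ} (hGD : G * D = 1) (lam : m → ℂ) (hlam : Q *ᵥ lam = 0) :
    gaugeR G Q *ᵥ (D *ᵥ lam) = D *ᵥ lam := by
  refine gaugeR_mulVec_of_ker G Q _ ?_
  rw [Matrix.mulVec_mulVec, Matrix.mulVec_mulVec, Matrix.mul_assoc, hGD, Matrix.mul_one, hlam]

/-- (3.21) IN BAŁABAN's WORDS, second half: `Q′·(G′·Rf) = 0` for every `f`, i.e. `Rf = Δ′_a(G′Rf)` with `G′Rf ∈ N(Q′)` — the range of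
`R` lies in `Δ′_a N(Q′)`. [cite: Balaban1985BackgroundPropagators, (3.21) p.394] [folklore] -/
theorem Q_mulVec_G_mulVec_gaugeR (hK : IsUnit (gramK G Q).det) (f : m → ℂ) : Q *ᵥ (G *ᵥ (gaugeR G Q *ᵥ f)) = 0 := by
  rw [Matrix.mulVec_mulVec, Matrix.mulVec_mulVec, Q_mul_G_mul_gaugeR G Q hK, Matrix.zero_mulVec]

/-! ## §3 Existence: coercivity of `Q′G′²Q′ᴴ` and the (3.48)-shape bound -/

omit [DecidableEq m] [DecidableEq u] in
/-- the quadratic form of `K`: `⟨v, Kv⟩ = ‖G·Qᴴ·v‖²` (for Hermitian `G`). [folklore] -/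
theorem form_gramK (hG : G.IsHermitian) (v : u → ℂ) :
    star v ⬝ᵥ (gramK G Q *ᵥ v) = ((nsq (G *ᵥ (Qᴴ *ᵥ v)) : ℝ) : ℂ) := by
  have e : gramK G Q *ᵥ v = Q *ᵥ (Gᴴ *ᵥ (G *ᵥ (Qᴴ *ᵥ v))) := by
    rw [hG.eq]; simp only [gramK, Matrix.mulVec_mulVec, Matrix.mul_assoc]
  rw [e, dotProduct_mulVec_eq_star_conjTranspose_mulVec, dotProduct_mulVec_eq_star_conjTranspose_mulVec,
    Matrix.conjTranspose_conjTranspose, star_dotProduct_self]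

omit [DecidableEq m] in
/-- `‖Qᴴv‖² = c‖v‖²` when `Q·Qᴴ = c·1` (real `c`). [folklore] -/
theorem nsq_QH_mulVec {c : ℝ} (hQ : Q * Qᴴ = (c : ℂ) • (1 : Matrix u u ℂ)) (v : u → ℂ) :
    nsq (Qᴴ *ᵥ v) = c * nsq v := by
  have h : star (Qᴴ *ᵥ v) ⬝ᵥ (Qᴴ *ᵥ v) = (c : ℂ) * (star v ⬝ᵥ v) := by
    rw [star_mulVec_dotProduct, Matrix.conjTranspose_conjTranspose, Matrix.mulVec_mulVec, hQ, Matrix.smul_mulVec,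
      Matrix.one_mulVec, dotProduct_smul, smul_eq_mul]
  rw [star_dotProduct_self, star_dotProduct_self, ← Complex.ofReal_mul] at h
  exact_mod_cast h

/-- **`Q′G′²Q′ᴴ` IS COERCIVE**: `G` Hermitian with a left inverse `D` (`D·G = 1`) and `Q·Qᴴ = c·1` ⟹ `(c/‖D‖²)·‖v‖² ≤ Re⟨v, Kv⟩`.
(«positivity of Δ′_a ⟹ positivity of Q′G′²Q′*», with the constant.) [cite: Balaban1985BackgroundPropagators, p.395 (existence of R)] [folklore] -/
theorem coercive_gramK (hG : G.IsHermitian) {D : Matrix m m ℂ} (hDG : D * G = 1) {c : ℝ}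
    (hQ : Q * Qᴴ = (c : ℂ) • (1 : Matrix u u ℂ)) : Coercive (gramK G Q) (c / ‖D‖ ^ 2) := by
  intro v
  rw [form_gramK G Q hG, Complex.ofReal_re]
  set w := Qᴴ *ᵥ v with hw
  -- `‖w‖² = ‖D(Gw)‖² ≤ ‖D‖²·‖Gw‖²`
  have h1 : nsq w ≤ ‖D‖ ^ 2 * nsq (G *ᵥ w) := by
    have : w = D *ᵥ (G *ᵥ w) := by rw [Matrix.mulVec_mulVec, hDG, Matrix.one_mulVec]
    conv_lhs => rw [this]
    exact nsq_mulVec_le D _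
  rw [nsq_QH_mulVec Q hQ] at h1
  by_cases hD : ‖D‖ = 0
  · rw [hD]; simp only [ne_eq, OfNat.ofNat_ne_zero, not_false_eq_true, zero_pow, div_zero, zero_mul]; exact nsq_nonneg _
  · have hD2 : 0 < ‖D‖ ^ 2 := by positivity
    rw [div_mul_eq_mul_div, div_le_iff₀ hD2]
    linarith

/-- a left inverse on a nonempty index type has positive norm. [folklore] -/
theorem norm_pos_of_mul_eq_one [Nonempty m] {D : Matrix m m ℂ} (hDG : D * G = 1) : 0 < ‖D‖ := by
  have h1 : (1 : ℝ) ≤ ‖D‖ * ‖G‖ := by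
    have h := Matrix.l2_opNorm_mul D G
    rw [hDG] at h
    have h1 : ‖(1 : Matrix m m ℂ)‖ = 1 := by
      rw [Matrix.l2_opNorm_def, ← ContinuousLinearMap.norm_id (𝕜 := ℂ) (E := EuclideanSpace ℂ m)]
      congr 1
      ext v i
      simp
    linarith
  rcases (norm_nonneg D).lt_or_eq with h | h
  · exact h
  · rw [← h, zero_mul] at h1; linarith

/-- **`Q′G′²Q′ᴴ` IS INVERTIBLE** («hence the existence of the operator R»). [cite: Balaban1985BackgroundPropagators, p.395] [folklore] -/
theorem isUnit_det_gramK (hG : G.IsHermitian) {D : Matrix m m ℂ} (hDG : D * G = 1) (hD : 0 < ‖D‖) {c : ℝ} (hc : 0 < c)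
    (hQ : Q * Qᴴ = (c : ℂ) • (1 : Matrix u u ℂ)) : IsUnit (gramK G Q).det :=
  isUnit_det_of_coercive (by positivity) (coercive_gramK G Q hG hDG hQ)

/-- **THE (3.48)-SHAPE BOUND**: `‖(Q′G′²Q′ᴴ)⁻¹‖ ≤ ‖Δ′_a‖²/c` (for Bałaban's normalised averaging `c = (L^jη)^{−d}`-type and `‖Δ′_a‖ ∼ η⁻²`
this is the printed `(L^jη)^{−4}`-type size, without the decay). [cite: Balaban1985BackgroundPropagators, Thm 3.2 (3.48) p.398 (shape)] [folklore] -/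
theorem opNorm_inv_gramK_le (hG : G.IsHermitian) {D : Matrix m m ℂ} (hDG : D * G = 1) (hD : 0 < ‖D‖) {c : ℝ} (hc : 0 < c)
    (hQ : Q * Qᴴ = (c : ℂ) • (1 : Matrix u u ℂ)) : ‖(gramK G Q)⁻¹‖ ≤ ‖D‖ ^ 2 / c := by
  have h := opNorm_inv_le_of_coercive (by positivity) (coercive_gramK G Q hG hDG hQ)
  rwa [inv_div] at h

/-! ## §4 Norms of the projections -/

omit [DecidableEq m] in
/-- a Hermitian idempotent is a contraction. [folklore] -/
theorem opNorm_le_one_of_proj [DecidableEq m] {P : Matrix m m ℂ} (hH : P.IsHermitian) (hP : P * P = P) : ‖P‖ ≤ 1 := by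
  refine opNorm_le_of_sq_le P zero_le_one fun x => ?_
  -- `‖Px‖² = ⟨Px, Px⟩ = ⟨x, PᴴP x⟩ = ⟨x, Px⟩ ≤ ‖x‖·‖Px‖`
  have e0 : ∑ i, ‖∑ j, P i j * x j‖ ^ 2 = nsq (P *ᵥ x) := rfl
  have e1 : ∑ j, ‖x j‖ ^ 2 = nsq x := rfl
  rw [e0, e1, one_pow, one_mul]
  have h1 : ((nsq (P *ᵥ x) : ℝ) : ℂ) = star x ⬝ᵥ (P *ᵥ x) := by
    rw [← star_dotProduct_self, star_mulVec_dotProduct, hH.eq, Matrix.mulVec_mulVec, hP]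
  have h2 : nsq (P *ᵥ x) ≤ Real.sqrt (nsq x) * Real.sqrt (nsq (P *ᵥ x)) := by
    have h := norm_star_dotProduct_le x (P *ᵥ x)
    rwa [← h1, Complex.norm_real, Real.norm_of_nonneg (nsq_nonneg _)] at h
  -- divide by `√(nsq (Px))`
  by_cases h0 : nsq (P *ᵥ x) = 0
  · rw [h0]; exact nsq_nonneg _
  · have hpos : 0 < Real.sqrt (nsq (P *ᵥ x)) := Real.sqrt_pos.mpr (lt_of_le_of_ne (nsq_nonneg _) (Ne.symm h0))
    have h3 : Real.sqrt (nsq (P *ᵥ x)) ≤ Real.sqrt (nsq x) := by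
      have h4 : Real.sqrt (nsq (P *ᵥ x)) * Real.sqrt (nsq (P *ᵥ x)) ≤ Real.sqrt (nsq x) * Real.sqrt (nsq (P *ᵥ x)) := by
        rw [Real.mul_self_sqrt (nsq_nonneg _)]; exact h2
      exact le_of_mul_le_mul_right h4 hpos
    calc nsq (P *ᵥ x) = Real.sqrt (nsq (P *ᵥ x)) ^ 2 := (Real.sq_sqrt (nsq_nonneg _)).symm
      _ ≤ Real.sqrt (nsq x) ^ 2 := pow_le_pow_left₀ (Real.sqrt_nonneg _) h3 2
      _ = nsq x := Real.sq_sqrt (nsq_nonneg _)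

/-- `‖P‖ ≤ 1`. [folklore] -/
theorem opNorm_gaugeP_le (hG : G.IsHermitian) (hK : IsUnit (gramK G Q).det) : ‖gaugeP G Q‖ ≤ 1 :=
  opNorm_le_one_of_proj (gaugeP_isHermitian G Q hG) (gaugeP_mul_gaugeP G Q hK)

/-- `‖R‖ ≤ 1`. [cite: Balaban1985BackgroundPropagators, (3.21) p.394 («orthogonal projection»)] [folklore] -/
theorem opNorm_gaugeR_le (hG : G.IsHermitian) (hK : IsUnit (gramK G Q).det) : ‖gaugeR G Q‖ ≤ 1 :=
  opNorm_le_one_of_proj (gaugeR_isHermitian G Q hG) (gaugeR_mul_gaugeR G Q hK)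

/-! ## §5 The minimisation (3.22) -/

omit [DecidableEq m] in
/-- Pythagoras for a Hermitian idempotent: `‖f − g‖² = ‖(1−R)f‖² + ‖Rf − g‖²` whenever `Rg = g`. [folklore] -/
theorem nsq_sub_eq_of_fixed {R : Matrix m m ℂ} (hH : R.IsHermitian) (hR : R * R = R) (f g : m → ℂ) (hg : R *ᵥ g = g) :
    nsq (f - g) = nsq (f - R *ᵥ f) + nsq (R *ᵥ f - g) := by
  -- decompose `f − g = (f − Rf) + (Rf − g)`, the two pieces are orthogonal
  have horth : star (f - R *ᵥ f) ⬝ᵥ (R *ᵥ f - g) = 0 := by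
    have e1 : R *ᵥ f - g = R *ᵥ (f - g) := by rw [Matrix.mulVec_sub, hg]
    have e2 : star (f - R *ᵥ f) ⬝ᵥ (R *ᵥ (f - g)) = star (Rᴴ *ᵥ (f - R *ᵥ f)) ⬝ᵥ (f - g) :=
      dotProduct_mulVec_eq_star_conjTranspose_mulVec R _ _
    have e3 : Rᴴ *ᵥ (f - R *ᵥ f) = 0 := by
      rw [hH.eq, Matrix.mulVec_sub, Matrix.mulVec_mulVec, hR, sub_self]
    rw [e1, e2, e3, star_zero, zero_dotProduct]
  have horth' : star (R *ᵥ f - g) ⬝ᵥ (f - R *ᵥ f) = 0 := by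
    rw [Matrix.star_dotProduct, horth, star_zero]
  have hdec : f - g = (f - R *ᵥ f) + (R *ᵥ f - g) := by abel
  have key : ((nsq (f - g) : ℝ) : ℂ) = ((nsq (f - R *ᵥ f) : ℝ) : ℂ) + ((nsq (R *ᵥ f - g) : ℝ) : ℂ) := by
    rw [← star_dotProduct_self, ← star_dotProduct_self, ← star_dotProduct_self, hdec, star_add, add_dotProduct, dotProduct_add,
      dotProduct_add, horth, horth', add_zero, zero_add]
  exact_mod_cast key

/-- **(3.22): `Rf` MINIMISES `λ ↦ ‖f − Δ′_aλ‖²` OVER `N(Q′)`** — for `G` Hermitian with `G·D = 1`, `gramK` invertible, every `f` and every `λ`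
with `Q′λ = 0`: `‖f − Rf‖² ≤ ‖f − Δ′_aλ‖²`. [cite: Balaban1985BackgroundPropagators, (3.22) p.394] [folklore] -/
theorem nsq_sub_gaugeR_le (hG : G.IsHermitian) (hK : IsUnit (gramK G Q).det) {D : Matrix m m ℂ} (hGD : G * D = 1)
    (f lam : m → ℂ) (hlam : Q *ᵥ lam = 0) :
    nsq (f - gaugeR G Q *ᵥ f) ≤ nsq (f - D *ᵥ lam) := by
  rw [nsq_sub_eq_of_fixed (gaugeR_isHermitian G Q hG) (gaugeR_mul_gaugeR G Q hK) f (D *ᵥ lam)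
    (gaugeR_mulVec_D_mulVec G Q hGD lam hlam)]
  exact le_add_of_nonneg_right (nsq_nonneg _)

end Summit.QuantumFields.BalabanUV.T4Continuum.RegionGaugeProjection

end
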